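import Summits.Ventures.PercRepro0.NewmanTransferFTC
import Summits.Ventures.PercRepro0.MidClose

/-!
# R_MID-12 · NEWMAN TRANSFER — the transfer (seat p2, part 4/4)

Lean twin of proofs/D7TRANSFER-p2-v1.md §5–§6 (cell pub-perc-repro0; lead RULING H (11)), on
`NewmanCluster.lean` / `NewmanTransferBox.lean` / `NewmanTransferFTC.lean`:

* the IDENTIFICATION LEMMA: for `L ≥ N`, `|C_L(0)| ≤ N` forces `C(0) = C_L(0)` (`cluster_eq_boxCluster`),
  so `|C_L(0)| ≤ N ↔ |C(0)| ≤ N` (`boxCluster_encard_le_iff`) and `S d N N p = P_p(|C(0)| ≤ N)`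
  (`S_eq_P_cluster`), which increases to `1 − θ_d(p)` (`tendsto_S`, continuity from below);
* LEMMA 5, the integrated Newman inequality (any `d ≥ 1`, `0 < p₁ ≤ p₂ < 1`, no hypothesis):
  `ofReal (θ_d(p₂) − θ_d(p₁)) ≤ ∫⁻_{(p₁, p₂]} ofReal (√d / (q √(1 − q))) · χ_d(q)^{1/2}` (`theta_sub_le`);
* R_MID-12 · NEWMAN TRANSFER (`newman_transfer`): for `d ≥ 2`, if
  `∫⁻ p in Set.Ioo 0 (pc d), (chi d (clamp p)) ^ (1/2 : ℝ) < ⊤` then `theta d (pc d) = 0` —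
  the statement of lead RULING H (11) verbatim; `d ≥ 2` enters only through `0 < p_c(d) < 1`.

Inputs beyond parts 1–3: `Defs.theta_eq_zero_of_lt_pc` (θ = 0 below `p_c`, the inf definition),
`MidClose.L4_Nontrivial_holds` / `MidClose.pc_lt_one` (`0 < p_c(d) < 1`, the only use of `d ≥ 2`),
`L2.nrm_le_of_adj` / `L2.nrm_le_length` / `L2.mem_box_iff` (the box geometry), `measurableSet_percolates`.
Census evidence only (the D7 door's TRANSFER): the hypothesis is asserted for NO `d`; nothing on
`T(d)`, `3 ≤ d ≤ 10`.
-/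

namespace Summit.Ventures.PercRepro0.Newman

open MeasureTheory ProbabilityTheory unitInterval Set Filter Topology
open Summit.Ventures.PercRepro0.Defs
open Summit.Ventures.PercRepro0.PcChi (chi)
open scoped ENNReal NNReal Classical

variable {d : ℕ}

/-! ### The identification lemma: `|C_L(0)| ≤ N` with `L ≥ N` forces `C_L(0) = C(0)` -/

/-- The box cluster lies in the box. -/
theorem boxCluster_subset_box (L : ℕ) (ω : Config d) : boxCluster d L ω ⊆ box d L := by
  intro y hy
  unfold boxCluster at hy
  rw [Set.mem_setOf_eq, boxConn_iff_reflTransGen] at hy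
  induction hy with
  | refl => exact fun i => by simp
  | @tail x z _ hxz _ => exact hxz.2.2 z (Sym2.mem_mk_right x z)

/-- The box cluster is contained in the cluster. -/
theorem boxCluster_subset_cluster (L : ℕ) (ω : Config d) : boxCluster d L ω ⊆ cluster d ω 0 :=
  fun _ hy => conn_mono Set.inter_subset_left hy

/-- The vertex set of `boxKF ω` is the box cluster (as sets). -/
theorem coe_vertF_boxKF (L : ℕ) (ω : Config d) :
    (↑(vertF d L (boxKF d L ω)) : Set (Vertex d)) = boxCluster d L ω := by
  ext x
  rw [Finset.mem_coe, mem_vertF_boxKF, Sharp.mem_boxF]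
  exact ⟨fun h => h.2, fun h => ⟨boxCluster_subset_box L ω h, h⟩⟩

/-- `|vertF (boxKF ω)| = encard (C_L(0))`. -/
theorem encard_boxCluster (L : ℕ) (ω : Config d) :
    (boxCluster d L ω).encard = ((vertF d L (boxKF d L ω)).card : ℕ∞) := by
  rw [← coe_vertF_boxKF, Set.encard_coe_eq_coe_finsetCard]

/-- Along a walk in the open graph of the box configuration, every vertex of the box cluster of `0` with
`|C_L(0)| ≤ N` has sup-norm `≤ N − 1`. -/
theorem nrm_le_of_mem_boxCluster {L N : ℕ} {ω : Config d} (hN : (boxCluster d L ω).encard ≤ N)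
    {y : Vertex d} (hy : y ∈ boxCluster d L ω) : L2.nrm y + 1 ≤ N := by
  have hfin : (boxCluster d L ω).Finite := Set.finite_of_encard_le_coe hN
  obtain ⟨wk⟩ := (hy : Conn d (ω ∩ boxBonds d L) 0 y)
  -- pass to a path (self-avoiding) from `0` to `y`
  set pth := wk.toPath with hpth
  have hpath : (pth : (openGraph d (ω ∩ boxBonds d L)).Walk 0 y).IsPath := pth.2
  have hsupp : ∀ v ∈ (pth : (openGraph d (ω ∩ boxBonds d L)).Walk 0 y).support, v ∈ boxCluster d L ω := by
    intro v hv
    exact ⟨(pth : (openGraph d (ω ∩ boxBonds d L)).Walk 0 y).takeUntil v hv⟩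
  have hnodup := hpath.support_nodup
  have hcard : (pth : (openGraph d (ω ∩ boxBonds d L)).Walk 0 y).support.toFinset.card ≤ N := by
    have h1 : (pth : (openGraph d (ω ∩ boxBonds d L)).Walk 0 y).support.toFinset ⊆ hfin.toFinset := by
      intro v hv
      rw [Set.Finite.mem_toFinset]
      exact hsupp v (List.mem_toFinset.1 hv)
    have h2 : (hfin.toFinset.card : ℕ∞) ≤ N := by
      rw [← Set.encard_coe_eq_coe_finsetCard, Set.Finite.coe_toFinset]; exact hN
    exact_mod_cast (Finset.card_le_card h1).trans (by exact_mod_cast h2)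
  have hlen : (pth : (openGraph d (ω ∩ boxBonds d L)).Walk 0 y).length + 1 ≤ N := by
    rw [← SimpleGraph.Walk.length_support, ← List.toFinset_card_of_nodup hnodup]
    exact hcard
  have := L2.nrm_le_length (pth : (openGraph d (ω ∩ boxBonds d L)).Walk 0 y)
  have h0 : L2.nrm (0 : Vertex d) = 0 := by simp [L2.nrm]
  omega

/-- The IDENTIFICATION LEMMA: if `|C_L(0)| ≤ N` and `L ≥ N`, then `C(0) = C_L(0)`. -/
theorem cluster_eq_boxCluster {L N : ℕ} (hLN : N ≤ L) {ω : Config d}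
    (hN : (boxCluster d L ω).encard ≤ N) : cluster d ω 0 = boxCluster d L ω := by
  refine Set.Subset.antisymm ?_ (boxCluster_subset_cluster L ω)
  intro y hy
  have hy' : Relation.ReflTransGen (L2.OAdj ω) 0 y := (L2.conn_iff_reflTransGen ω 0 y).1 hy
  clear hy
  induction hy' with
  | refl => exact zero_mem_boxCluster L ω
  | @tail x z _ hxz ih =>
    have hx : L2.nrm x + 1 ≤ N := nrm_le_of_mem_boxCluster hN ih
    have hz : L2.nrm z ≤ L2.nrm x + 1 := L2.nrm_le_of_adj hxz.1
    have hbox : s(x, z) ∈ boxBonds d L := by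
      intro v hv
      rw [L2.mem_box_iff]
      rcases Sym2.mem_iff.1 hv with rfl | rfl
      · omega
      · omega
    exact mem_boxCluster_of_oAdj ih ⟨hxz.1, Set.mem_inter hxz.2 hbox⟩

/-- For `L ≥ N`: `|C_L(0)| ≤ N ↔ |C(0)| ≤ N`. -/
theorem boxCluster_encard_le_iff {L N : ℕ} (hLN : N ≤ L) (ω : Config d) :
    (boxCluster d L ω).encard ≤ N ↔ (cluster d ω 0).encard ≤ N := by
  constructor
  · intro h
    rw [cluster_eq_boxCluster hLN h]
    exact h
  · intro h
    exact (Set.encard_mono (boxCluster_subset_cluster L ω)).trans h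

/-- `S_{N,N}(p) = P_p(|C(0)| ≤ N)`. -/
theorem S_eq_P_cluster (N : ℕ) (p : I) :
    S d N N p = (P d p {ω : Config d | (cluster d ω 0).encard ≤ N}).toReal := by
  rw [S_eq_P]
  congr 2
  ext ω
  simp only [Set.mem_setOf_eq]
  rw [← boxCluster_encard_le_iff le_rfl ω, encard_boxCluster]
  constructor
  · intro h; exact_mod_cast h
  · intro h; exact_mod_cast h

/-! ### Continuity from below: `P_p(|C(0)| ≤ N) ↑ 1 − θ_d(p)` -/

/-- The events `{|C(0)| ≤ N}` increase to `{|C(0)| < ∞} = {0 ↔ ∞}ᶜ`. -/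
theorem iUnion_encard_le :
    (⋃ N : ℕ, {ω : Config d | (cluster d ω 0).encard ≤ N}) = (percolates d)ᶜ := by
  ext ω
  simp only [Set.mem_iUnion, Set.mem_setOf_eq, Set.mem_compl_iff, percolates, ConnInf]
  constructor
  · rintro ⟨N, hN⟩ hinf
    exact absurd (Set.finite_of_encard_le_coe hN) hinf
  · intro hfin
    have hf : (cluster d ω 0).Finite := Set.not_infinite.1 hfin
    exact ⟨hf.toFinset.card, by
      rw [← Set.encard_coe_eq_coe_finsetCard, Set.Finite.coe_toFinset]⟩

/-- Monotonicity in `N` of the events `{|C(0)| ≤ N}`. -/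
theorem monotone_encard_le :
    Monotone (fun N : ℕ => {ω : Config d | (cluster d ω 0).encard ≤ N}) := by
  intro N M hNM ω hω
  simp only [Set.mem_setOf_eq] at hω ⊢
  exact le_trans hω (by exact_mod_cast hNM)

/-- `S_{N,N}(p) → 1 − θ_d(p)` as `N → ∞`. -/
theorem tendsto_S (p : I) :
    Tendsto (fun N : ℕ => S d N N p) atTop (𝓝 (1 - thetaI d p)) := by
  have h := tendsto_measure_iUnion_atTop (μ := P d p)
    (s := fun N : ℕ => {ω : Config d | (cluster d ω 0).encard ≤ N}) monotone_encard_le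
  rw [iUnion_encard_le, prob_compl_eq_one_sub measurableSet_percolates] at h
  have h' := (ENNReal.tendsto_toReal (by simp)).comp h
  simp only [Function.comp_def] at h'
  rw [ENNReal.toReal_sub_of_le prob_le_one ENNReal.one_ne_top, ENNReal.toReal_one] at h'
  refine h'.congr fun N => ?_
  exact (S_eq_P_cluster N p).symm

/-! ### LEMMA 5: the integrated Newman inequality (any `d ≥ 1`, no hypothesis) -/

/-- The integrated Newman inequality: for `0 < p₁ ≤ p₂ < 1`,
`ofReal (θ_d(p₂) − θ_d(p₁)) ≤ ∫⁻_{(p₁, p₂]} ofReal (√d / (q √(1 − q))) · χ_d(q)^{1/2}`. -/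
theorem theta_sub_le {p₁ p₂ : ℝ} (h0 : 0 < p₁) (h12 : p₁ ≤ p₂) (h1 : p₂ < 1) :
    ENNReal.ofReal (theta d p₂ - theta d p₁) ≤ ∫⁻ q in Set.Ioc p₁ p₂, kernel d q := by
  have hp₁ : ((clamp p₁ : I) : ℝ) = p₁ := PcChi.coe_clamp_of_mem ⟨h0.le, by linarith⟩
  have hp₂ : ((clamp p₂ : I) : ℝ) = p₂ := PcChi.coe_clamp_of_mem ⟨by linarith, h1.le⟩
  have h₁ := tendsto_S (d := d) (clamp p₁)
  have h₂ := tendsto_S (d := d) (clamp p₂)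
  rw [hp₁] at h₁
  rw [hp₂] at h₂
  have htend : Tendsto (fun N : ℕ => ENNReal.ofReal (S d N N p₁ - S d N N p₂)) atTop
      (𝓝 (ENNReal.ofReal ((1 - thetaI d (clamp p₁)) - (1 - thetaI d (clamp p₂))))) :=
    (ENNReal.continuous_ofReal.tendsto _).comp (h₁.sub h₂)
  have heq : (1 - thetaI d (clamp p₁)) - (1 - thetaI d (clamp p₂)) = theta d p₂ - theta d p₁ := by
    unfold theta; ring
  rw [heq] at htend
  exact le_of_tendsto' htend fun N => ofReal_S_sub_le_lintegral N N h0 h12 h1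

/-! ### R_MID-12 · NEWMAN TRANSFER -/

/-- `0 < p_c(d)` for `d ≥ 2` (from L4). -/
theorem pc_pos' (hd : 2 ≤ d) : 0 < pc d := by
  have h := (MidClose.L4_Nontrivial_holds hd).1.1
  have hd' : (0 : ℝ) < 2 * (d : ℝ) - 1 := by
    have : (2 : ℝ) ≤ d := by exact_mod_cast hd
    linarith
  exact lt_of_lt_of_le (by positivity) h

/-- The kernel is dominated by a constant times `χ_q^{1/2}` on `(a, p_c(d)]`. -/
theorem kernel_le {a c : ℝ} (ha : 0 < a) (hc : c < 1) {q : ℝ} (hq : q ∈ Set.Ioc a c) :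
    kernel d q ≤ ENNReal.ofReal (Real.sqrt d / (a * Real.sqrt (1 - c))) * (chi d (clamp q)) ^ (1 / 2 : ℝ) := by
  unfold kernel
  refine mul_le_mul' (ENNReal.ofReal_le_ofReal ?_) le_rfl
  have h1 : 0 < 1 - c := by linarith
  have h2 : 1 - c ≤ 1 - q := by linarith [hq.2]
  have h3 : 0 < Real.sqrt (1 - c) := Real.sqrt_pos.2 h1
  have h4 : a * Real.sqrt (1 - c) ≤ q * Real.sqrt (1 - q) :=
    mul_le_mul hq.1.le (Real.sqrt_le_sqrt h2) h3.le (by linarith [hq.1])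
  exact div_le_div_of_nonneg_left (Real.sqrt_nonneg _) (by positivity) h4

/-- `p ↦ χ_d(clamp p)^{1/2}` is measurable. -/
theorem measurable_chi_rpow : Measurable fun q : ℝ => (chi d (clamp q)) ^ (1 / 2 : ℝ) := by
  have h : Measurable fun q : ℝ => chi d (clamp q) := by
    have : (fun q : ℝ => chi d (clamp q)) = fun q => ⨆ n : ℕ, ENNReal.ofReal (ChiLower.chiBox d n q) := by
      funext q
      rw [ChiLower.chi_eq_iSup_chiBoxE]
      refine iSup_congr fun n => ?_
      rw [← ChiLower.toReal_chiBoxE, ENNReal.ofReal_toReal (ChiLower.chiBoxE_ne_top n _)]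
    rw [this]
    exact Measurable.iSup fun n => ENNReal.measurable_ofReal.comp (ChiLower.continuous_chiBox n).measurable
  exact (ENNReal.continuous_rpow_const.measurable).comp h

/-- R_MID-12 · NEWMAN TRANSFER (lead RULING H (11), the statement verbatim): for `d ≥ 2`, if
`∫_0^{p_c(d)} χ_d(p)^{1/2} dp < ∞` then `θ_d(p_c(d)) = 0`. The hypothesis is asserted for NO `d`. -/
theorem newman_transfer (hd : 2 ≤ d)
    (hχ : ∫⁻ p in Set.Ioo 0 (pc d), (chi d (clamp p)) ^ (1 / 2 : ℝ) < ⊤) : theta d (pc d) = 0 := by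
  set c := pc d with hc
  have hc0 : 0 < c := pc_pos' hd
  have hc1 : c < 1 := MidClose.pc_lt_one hd
  have hd1 : 1 ≤ d := by omega
  -- the density measure of `χ^{1/2}`
  set ν : Measure ℝ := volume.withDensity fun q => (chi d (clamp q)) ^ (1 / 2 : ℝ) with hν
  have hνfin : ν (Set.Ioo 0 c) < ⊤ := by
    rw [hν, withDensity_apply _ measurableSet_Ioo]; exact hχ
  -- the sequence `a_n ↑ c`
  set a : ℕ → ℝ := fun n => c - c / (n + 2) with ha
  have ha_pos : ∀ n, 0 < a n := fun n => by
    simp only [ha]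
    have : c / (n + 2) < c := by
      rw [div_lt_iff₀ (by positivity)]
      have : (1 : ℝ) < n + 2 := by
        have : (0 : ℝ) ≤ n := Nat.cast_nonneg n
        linarith
      nlinarith
    linarith
  have ha_lt : ∀ n, a n < c := fun n => by
    simp only [ha]
    have : 0 < c / (n + 2) := by positivity
    linarith
  have ha_mono : Monotone a := by
    intro n m hnm
    simp only [ha]
    have h1 : (0 : ℝ) < n + 2 := by positivity
    have h2 : (n : ℝ) + 2 ≤ m + 2 := by
      have : (n : ℝ) ≤ m := by exact_mod_cast hnm
      linarith
    have : c / (m + 2) ≤ c / (n + 2) := div_le_div_of_nonneg_left hc0.le h1 h2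
    linarith
  have ha_tend : Tendsto a atTop (𝓝 c) := by
    have h1 : Tendsto (fun n : ℕ => c / ((n : ℝ) + 2)) atTop (𝓝 0) := by
      have := tendsto_natCast_atTop_atTop (R := ℝ)
      have h2 : Tendsto (fun n : ℕ => (n : ℝ) + 2) atTop atTop :=
        tendsto_atTop_add_const_right _ 2 this
      exact (tendsto_const_nhds.div_atTop h2)
    have h2 := (tendsto_const_nhds (x := c)).sub h1
    rw [sub_zero] at h2
    exact h2
  -- the tail integrals tend to `0`
  have hinter : (⋂ n, Set.Ioo (a n) c) = ∅ := by
    ext q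
    simp only [Set.mem_iInter, Set.mem_Ioo, Set.mem_empty_iff_false, iff_false]
    intro h
    have hcq : c ≤ q := le_of_tendsto' ha_tend fun n => (h n).1.le
    linarith [(h 0).2]
  have htail : Tendsto (fun n : ℕ => ν (Set.Ioo (a n) c)) atTop (𝓝 0) := by
    have h := tendsto_measure_iInter_atTop (μ := ν) (s := fun n => Set.Ioo (a n) c)
      (fun n => measurableSet_Ioo.nullMeasurableSet)
      (fun n m hnm => Set.Ioo_subset_Ioo_left (ha_mono hnm))
      ⟨0, (measure_mono (Set.Ioo_subset_Ioo_left (ha_pos 0).le)).trans_lt hνfin |>.ne⟩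
    rwa [hinter, measure_empty] at h
  -- the bound for each `n`
  set C : ℝ≥0∞ := ENNReal.ofReal (Real.sqrt d / (a 0 * Real.sqrt (1 - c))) with hC
  have hbound : ∀ n, ENNReal.ofReal (theta d c) ≤ C * ν (Set.Ioo (a n) c) := by
    intro n
    have hθa : theta d (a n) = 0 := theta_eq_zero_of_lt_pc hd1 (ha_pos n).le (ha_lt n)
    have h1 : ENNReal.ofReal (theta d c) = ENNReal.ofReal (theta d c - theta d (a n)) := by
      rw [hθa, sub_zero]
    rw [h1]
    refine (theta_sub_le (ha_pos n) (ha_lt n).le hc1).trans ?_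
    have hCn : ENNReal.ofReal (Real.sqrt d / (a n * Real.sqrt (1 - c))) ≤ C := by
      rw [hC]
      refine ENNReal.ofReal_le_ofReal ?_
      have h0' : 0 < a 0 := ha_pos 0
      have hs : 0 < Real.sqrt (1 - c) := Real.sqrt_pos.2 (by linarith)
      refine div_le_div_of_nonneg_left (Real.sqrt_nonneg _) (by positivity) ?_
      exact mul_le_mul_of_nonneg_right (ha_mono (Nat.zero_le n)) hs.le
    calc ∫⁻ q in Set.Ioc (a n) c, kernel d q
        ≤ ∫⁻ q in Set.Ioc (a n) c,
            ENNReal.ofReal (Real.sqrt d / (a n * Real.sqrt (1 - c))) * (chi d (clamp q)) ^ (1 / 2 : ℝ) := by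
          refine lintegral_mono_ae ?_
          filter_upwards [ae_restrict_mem measurableSet_Ioc] with q hq
          exact kernel_le (ha_pos n) hc1 hq
      _ = ENNReal.ofReal (Real.sqrt d / (a n * Real.sqrt (1 - c))) *
            ∫⁻ q in Set.Ioc (a n) c, (chi d (clamp q)) ^ (1 / 2 : ℝ) :=
          lintegral_const_mul' _ _ ENNReal.ofReal_ne_top
      _ = ENNReal.ofReal (Real.sqrt d / (a n * Real.sqrt (1 - c))) *
            ∫⁻ q in Set.Ioo (a n) c, (chi d (clamp q)) ^ (1 / 2 : ℝ) := by
          rw [← MeasureTheory.restrict_Ioo_eq_restrict_Ioc]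
      _ = ENNReal.ofReal (Real.sqrt d / (a n * Real.sqrt (1 - c))) * ν (Set.Ioo (a n) c) := by
          rw [hν, withDensity_apply _ measurableSet_Ioo]
      _ ≤ C * ν (Set.Ioo (a n) c) := by gcongr
  -- conclude
  have hlim : Tendsto (fun n : ℕ => C * ν (Set.Ioo (a n) c)) atTop (𝓝 (C * 0)) :=
    ENNReal.Tendsto.const_mul htail (Or.inr ENNReal.ofReal_ne_top)
  rw [mul_zero] at hlim
  have h0 : ENNReal.ofReal (theta d c) ≤ 0 := ge_of_tendsto' hlim hbound
  have h0' : ENNReal.ofReal (theta d c) = 0 := le_antisymm h0 zero_le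
  rw [ENNReal.ofReal_eq_zero] at h0'
  exact le_antisymm h0' (theta_nonneg d c)

end Summit.Ventures.PercRepro0.Newman
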